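import Summits.BirchSwinnertonDyer.BirchSwinnertonDyer.Theorems.Rank1ResidualJetCarrierMultKitOrder
import Summits.BirchSwinnertonDyer.BirchSwinnertonDyer.Theorems.Rank1ResidualJetCarrierAddKit
import HarnessLib

/-!
# T1 JET (cell `bsd-jet`), bucket B of `JET@p∣N`: by-name SAMPLE ROWS for the forthcoming
# OFFER-JET-DOCSTRIKE-BUCKET-B (director-bsd 2026-08-27T02:36:54Z «pre-stage»; referee C R416 grammar) —
# file 1 of 3: B-add (carrier 3, E additive IV/IV* at 3), road A, 8 cells

HONEST FRAMING (programme file §HONESTY, verbatim): «no tranche here proves BSD; ARM L moves the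
LITERAL column of an r ≤ 1 census into the kernel-proved-modulo-named-print column.» THEOREMS ONLY
(seat `bsd-jet-pv-2`, session g2; `--supports stmt-BirchSwinnertonDyer-14418`, helper). Each record is
`BSDp W p` for one census cell of `HOME/census-jet/jet_keys_B_classes.tsv` 4c8599cf93bc5459 through the
landed kits (`Rank1ResidualJetCarrierMultKit.lean` p465088, `…MultKitOrder.lean` p474328,
`…CarrierAddKit.lean` p475627), with every numeric hypothesis (`Δ ≠ 0`, the support-form Kraus
certificate, reduction type at `p`, the image witnesses) re-verified by `decide`/`norm_num` in the
kernel from the kit witness tables `HOME/sheets/pv2-B3-witness/` (j262920) and `pv2-B5-witness/`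
(j263826); the READING binder (`JET.JetchevDivisibilityCarrierMult` = K3 or `…CarrierAdd` = K4,
referee C R385/R416: GAPPED-in-print, gap closed BY NAME), the published binders, the Heegner datum,
the index line at the carrier and `#Ш_an` stay DISPLAYED. The stratified sample (road × p × Kodaira
type × rank) is the bucket-B analogue of the 55-row DOCSTRIKE-A sample (ty, JetDocstrikeARecords01–07).
CONDITIONAL; nothing is booked by this file; 0 classes move.
References: [Jetchev2008] Cor. 1.5; [Cremona2006] Table 1; [Serre1972] §2.4 Prop. 15, §2.8 Prop. 19;
[Kraus1989] Prop. 1–2; [Wuthrich2014] Lemma 20; [Elkies2006] (mod-9 tower witness).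
-/

set_option autoImplicit false

noncomputable section

open scoped Classical

open WeierstrassCurve Literature.NumberTheory.EllipticCurves
  Literature.NumberTheory.EllipticCurves.ModularForms
  Literature.NumberTheory.EllipticCurves.Rank1Residual
  Literature.NumberTheory.EllipticCurves.Rank1Residual.X11RankOneCertificates
  Summit.BirchSwinnertonDyer.BirchSwinnertonDyer.Rank1Residual
  Summit.BirchSwinnertonDyer.BirchSwinnertonDyer.Rank1Residual.IntModel
  Summit.BirchSwinnertonDyer.BirchSwinnertonDyer.Rank1Residual.X11RankOne
  Summit.BirchSwinnertonDyer.Rank1Residual Summit.BirchSwinnertonDyer.Rank1Residual.X11b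

namespace Summit.BirchSwinnertonDyer.Rank1Residual.JET

/-- **`BSD(E,3)` for `1674h1`, bucket B-add, road A** (`N = 1674`, `r = 1`, Kodaira `IV` at `3`,
`c₃ = 3`, `D = -23`; model `[1,-1,1,4,15]`, `Δ = -120528`, support `2:4;3:5;31:1`): kit
`JET.bsdp_of_jetRowCarrierAdd_three_of_frobenius` with Frobenius witnesses irr `(5, 8)`, order-3 `(7, 6)`,
mod-9 `(11, 18)` (kit table `HOME/sheets/pv2-B3-witness/witness_B_p3.tsv`, job j262920). Displayed binders: `hJ`
(READING K4), the published `hMcU` … `hlev`, the Heegner datum and the index line at the carrier `3`. CONDITIONAL;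
nothing booked. [cite: Jetchev2008, Cor. 1.5 (p. 812)] [cite: Cremona2006, Table 1 (label 1674h1)] -/
theorem bsdp_jetBadd_1674h1_3_frobenius
    (hJ : JetchevDivisibilityCarrierAdd)
    (hMcU : McCallum1991_padicValNat_card_sha_primary_add_le_of_globalDivisibility)
    (hGZK : rank_eq_analyticRank_of_analyticRank_le_one)
    (hKo : ∀ (N : ℕ) [NeZero N] (W : WeierstrassCurve ℚ) (K : Type) [Field K] [NumberField K],
      kolyvagin N W K)
    (hrec : ∀ (N : ℕ) [NeZero N] (W : WeierstrassCurve ℚ) (K : Type) [Field K] [NumberField K],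
      heegnerPointOfConductor_one_galoisConj N W K)
    (hD36 : ∀ (N : ℕ) [NeZero N] (W : WeierstrassCurve ℚ) (K : Type) [Field K] [NumberField K],
      phi_heegnerTau_mem_singularModuliField N W K)
    (hlev : ∀ {N : ℕ} [NeZero N], IsNewformOf.level_eq_conductorNorm (N := N))
    (W : WeierstrassCurve ℚ) (hW : W = ⟨1, (-1), 1, 4, 15⟩)
    {N : ℕ} [NeZero N] {K : Type} [Field K] [NumberField K] (hK : IsImaginaryQuadratic K)
    (hD3 : NumberField.discr K ≠ -3) (hD4 : NumberField.discr K ≠ -4)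
    (hH : SatisfiesHeegnerHypothesis N K) {P : (W.baseChange K).toAffine.Point}
    (hP : IsHeegnerPoint N W K P) (hnt : ¬ IsOfFinAddOrder P)
    (hI : padicValNat 3 (AddSubgroup.zmultiples P).index ≤
      padicValNat 3 ((W.baseChange ℚ_[3]).localTamagawaNumber ℤ_[3]))
    (hr : W.analyticRank ≤ 1) {s : ℚ} (hs : shaAn W = (s : ℂ)) (hv : padicValRat 3 s = 0) :
    BSDp W 3 :=
  bsdp_of_jetRowCarrierAdd_three_of_frobenius 1 (-1) 1 4 15 (by decide +kernel)
    [(2, 1, 4), (3, 3, 5), (31, 1, 1)]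
    (by intro t ht; simp only [List.mem_cons, List.not_mem_nil, or_false] at ht
        rcases ht with rfl | rfl | rfl <;> norm_num)
    (by decide +kernel) (by decide +kernel) (by decide +kernel) (by decide +kernel)
    5 7 11 (by norm_num) (by norm_num) (by norm_num) (by norm_num) (by norm_num) (by norm_num)
    (by norm_num) (by norm_num) (by decide +kernel) (by decide +kernel) (by decide +kernel)
    (n₁ := 8) (n₂ := 6) (n₃ := 18) (by decide +kernel) (by decide +kernel) (by decide +kernel)
    (by decide) (by decide) (by decide) hJ hMcU hGZK hKo hrec hD36 hlev W hW hK hD3 hD4 hH hP hnt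
    hI hr hs hv

/-- **`BSD(E,3)` for `2808k1`, bucket B-add, road A** (`N = 2808`, `r = 0`, Kodaira `IV` at `3`,
`c₃ = 3`, `D = -23`; model `[0,0,0,-1011,-12373]`, `Δ = -50544`, support `2:4;3:5;13:1`): kit
`JET.bsdp_of_jetRowCarrierAdd_three_of_frobenius` with Frobenius witnesses irr `(11, 16)`, order-3 `(7, 6)`,
mod-9 `(5, 3)` (kit table `HOME/sheets/pv2-B3-witness/witness_B_p3.tsv`, job j262920). Displayed binders: `hJ`
(READING K4), the published `hMcU` … `hlev`, the Heegner datum and the index line at the carrier `3`. CONDITIONAL;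
nothing booked. [cite: Jetchev2008, Cor. 1.5 (p. 812)] [cite: Cremona2006, Table 1 (label 2808k1)] -/
theorem bsdp_jetBadd_2808k1_3_frobenius
    (hJ : JetchevDivisibilityCarrierAdd)
    (hMcU : McCallum1991_padicValNat_card_sha_primary_add_le_of_globalDivisibility)
    (hGZK : rank_eq_analyticRank_of_analyticRank_le_one)
    (hKo : ∀ (N : ℕ) [NeZero N] (W : WeierstrassCurve ℚ) (K : Type) [Field K] [NumberField K],
      kolyvagin N W K)
    (hrec : ∀ (N : ℕ) [NeZero N] (W : WeierstrassCurve ℚ) (K : Type) [Field K] [NumberField K],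
      heegnerPointOfConductor_one_galoisConj N W K)
    (hD36 : ∀ (N : ℕ) [NeZero N] (W : WeierstrassCurve ℚ) (K : Type) [Field K] [NumberField K],
      phi_heegnerTau_mem_singularModuliField N W K)
    (hlev : ∀ {N : ℕ} [NeZero N], IsNewformOf.level_eq_conductorNorm (N := N))
    (W : WeierstrassCurve ℚ) (hW : W = ⟨0, 0, 0, (-1011), (-12373)⟩)
    {N : ℕ} [NeZero N] {K : Type} [Field K] [NumberField K] (hK : IsImaginaryQuadratic K)
    (hD3 : NumberField.discr K ≠ -3) (hD4 : NumberField.discr K ≠ -4)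
    (hH : SatisfiesHeegnerHypothesis N K) {P : (W.baseChange K).toAffine.Point}
    (hP : IsHeegnerPoint N W K P) (hnt : ¬ IsOfFinAddOrder P)
    (hI : padicValNat 3 (AddSubgroup.zmultiples P).index ≤
      padicValNat 3 ((W.baseChange ℚ_[3]).localTamagawaNumber ℤ_[3]))
    (hr : W.analyticRank ≤ 1) {s : ℚ} (hs : shaAn W = (s : ℂ)) (hv : padicValRat 3 s = 0) :
    BSDp W 3 :=
  bsdp_of_jetRowCarrierAdd_three_of_frobenius 0 0 0 (-1011) (-12373) (by decide +kernel)
    [(2, 3, 4), (3, 3, 5), (13, 1, 1)]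
    (by intro t ht; simp only [List.mem_cons, List.not_mem_nil, or_false] at ht
        rcases ht with rfl | rfl | rfl <;> norm_num)
    (by decide +kernel) (by decide +kernel) (by decide +kernel) (by decide +kernel)
    11 7 5 (by norm_num) (by norm_num) (by norm_num) (by norm_num) (by norm_num) (by norm_num)
    (by norm_num) (by norm_num) (by decide +kernel) (by decide +kernel) (by decide +kernel)
    (n₁ := 16) (n₂ := 6) (n₃ := 3) (by decide +kernel) (by decide +kernel) (by decide +kernel)
    (by decide) (by decide) (by decide) hJ hMcU hGZK hKo hrec hD36 hlev W hW hK hD3 hD4 hH hP hnt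
    hI hr hs hv

/-- **`BSD(E,3)` for `5022e1`, bucket B-add, road A** (`N = 5022`, `r = 1`, Kodaira `IV*` at `3`,
`c₃ = 3`, `D = -23`; model `[1,-1,0,-5226,-145036]`, `Δ = -116215990272`, support `2:11;3:10;31:2`): kit
`JET.bsdp_of_jetRowCarrierAdd_three_of_frobenius` with Frobenius witnesses irr `(5, 4)`, order-3 `(7, 12)`,
mod-9 `(11, 15)` (kit table `HOME/sheets/pv2-B3-witness/witness_B_p3.tsv`, job j262920). Displayed binders: `hJ`
(READING K4), the published `hMcU` … `hlev`, the Heegner datum and the index line at the carrier `3`. CONDITIONAL;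
nothing booked. [cite: Jetchev2008, Cor. 1.5 (p. 812)] [cite: Cremona2006, Table 1 (label 5022e1)] -/
theorem bsdp_jetBadd_5022e1_3_frobenius
    (hJ : JetchevDivisibilityCarrierAdd)
    (hMcU : McCallum1991_padicValNat_card_sha_primary_add_le_of_globalDivisibility)
    (hGZK : rank_eq_analyticRank_of_analyticRank_le_one)
    (hKo : ∀ (N : ℕ) [NeZero N] (W : WeierstrassCurve ℚ) (K : Type) [Field K] [NumberField K],
      kolyvagin N W K)
    (hrec : ∀ (N : ℕ) [NeZero N] (W : WeierstrassCurve ℚ) (K : Type) [Field K] [NumberField K],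
      heegnerPointOfConductor_one_galoisConj N W K)
    (hD36 : ∀ (N : ℕ) [NeZero N] (W : WeierstrassCurve ℚ) (K : Type) [Field K] [NumberField K],
      phi_heegnerTau_mem_singularModuliField N W K)
    (hlev : ∀ {N : ℕ} [NeZero N], IsNewformOf.level_eq_conductorNorm (N := N))
    (W : WeierstrassCurve ℚ) (hW : W = ⟨1, (-1), 0, (-5226), (-145036)⟩)
    {N : ℕ} [NeZero N] {K : Type} [Field K] [NumberField K] (hK : IsImaginaryQuadratic K)
    (hD3 : NumberField.discr K ≠ -3) (hD4 : NumberField.discr K ≠ -4)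
    (hH : SatisfiesHeegnerHypothesis N K) {P : (W.baseChange K).toAffine.Point}
    (hP : IsHeegnerPoint N W K P) (hnt : ¬ IsOfFinAddOrder P)
    (hI : padicValNat 3 (AddSubgroup.zmultiples P).index ≤
      padicValNat 3 ((W.baseChange ℚ_[3]).localTamagawaNumber ℤ_[3]))
    (hr : W.analyticRank ≤ 1) {s : ℚ} (hs : shaAn W = (s : ℂ)) (hv : padicValRat 3 s = 0) :
    BSDp W 3 :=
  bsdp_of_jetRowCarrierAdd_three_of_frobenius 1 (-1) 0 (-5226) (-145036) (by decide +kernel)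
    [(2, 1, 11), (3, 4, 10), (31, 1, 2)]
    (by intro t ht; simp only [List.mem_cons, List.not_mem_nil, or_false] at ht
        rcases ht with rfl | rfl | rfl <;> norm_num)
    (by decide +kernel) (by decide +kernel) (by decide +kernel) (by decide +kernel)
    5 7 11 (by norm_num) (by norm_num) (by norm_num) (by norm_num) (by norm_num) (by norm_num)
    (by norm_num) (by norm_num) (by decide +kernel) (by decide +kernel) (by decide +kernel)
    (n₁ := 4) (n₂ := 12) (n₃ := 15) (by decide +kernel) (by decide +kernel) (by decide +kernel)
    (by decide) (by decide) (by decide) hJ hMcU hGZK hKo hrec hD36 hlev W hW hK hD3 hD4 hH hP hnt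
    hI hr hs hv

/-- **`BSD(E,3)` for `5967c1`, bucket B-add, road A** (`N = 5967`, `r = 1`, Kodaira `IV*` at `3`,
`c₃ = 3`, `D = -35`; model `[0,0,1,27,-358]`, `Δ = -56549259`, support `3:9;13:2;17:1`): kit
`JET.bsdp_of_jetRowCarrierAdd_three_of_frobenius` with Frobenius witnesses irr `(5, 7)`, order-3 `(7, 12)`,
mod-9 `(11, 15)` (kit table `HOME/sheets/pv2-B3-witness/witness_B_p3.tsv`, job j262920). Displayed binders: `hJ`
(READING K4), the published `hMcU` … `hlev`, the Heegner datum and the index line at the carrier `3`. CONDITIONAL;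
nothing booked. [cite: Jetchev2008, Cor. 1.5 (p. 812)] [cite: Cremona2006, Table 1 (label 5967c1)] -/
theorem bsdp_jetBadd_5967c1_3_frobenius
    (hJ : JetchevDivisibilityCarrierAdd)
    (hMcU : McCallum1991_padicValNat_card_sha_primary_add_le_of_globalDivisibility)
    (hGZK : rank_eq_analyticRank_of_analyticRank_le_one)
    (hKo : ∀ (N : ℕ) [NeZero N] (W : WeierstrassCurve ℚ) (K : Type) [Field K] [NumberField K],
      kolyvagin N W K)
    (hrec : ∀ (N : ℕ) [NeZero N] (W : WeierstrassCurve ℚ) (K : Type) [Field K] [NumberField K],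
      heegnerPointOfConductor_one_galoisConj N W K)
    (hD36 : ∀ (N : ℕ) [NeZero N] (W : WeierstrassCurve ℚ) (K : Type) [Field K] [NumberField K],
      phi_heegnerTau_mem_singularModuliField N W K)
    (hlev : ∀ {N : ℕ} [NeZero N], IsNewformOf.level_eq_conductorNorm (N := N))
    (W : WeierstrassCurve ℚ) (hW : W = ⟨0, 0, 1, 27, (-358)⟩)
    {N : ℕ} [NeZero N] {K : Type} [Field K] [NumberField K] (hK : IsImaginaryQuadratic K)
    (hD3 : NumberField.discr K ≠ -3) (hD4 : NumberField.discr K ≠ -4)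
    (hH : SatisfiesHeegnerHypothesis N K) {P : (W.baseChange K).toAffine.Point}
    (hP : IsHeegnerPoint N W K P) (hnt : ¬ IsOfFinAddOrder P)
    (hI : padicValNat 3 (AddSubgroup.zmultiples P).index ≤
      padicValNat 3 ((W.baseChange ℚ_[3]).localTamagawaNumber ℤ_[3]))
    (hr : W.analyticRank ≤ 1) {s : ℚ} (hs : shaAn W = (s : ℂ)) (hv : padicValRat 3 s = 0) :
    BSDp W 3 :=
  bsdp_of_jetRowCarrierAdd_three_of_frobenius 0 0 1 27 (-358) (by decide +kernel)
    [(3, 3, 9), (13, 1, 2), (17, 1, 1)]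
    (by intro t ht; simp only [List.mem_cons, List.not_mem_nil, or_false] at ht
        rcases ht with rfl | rfl | rfl <;> norm_num)
    (by decide +kernel) (by decide +kernel) (by decide +kernel) (by decide +kernel)
    5 7 11 (by norm_num) (by norm_num) (by norm_num) (by norm_num) (by norm_num) (by norm_num)
    (by norm_num) (by norm_num) (by decide +kernel) (by decide +kernel) (by decide +kernel)
    (n₁ := 7) (n₂ := 12) (n₃ := 15) (by decide +kernel) (by decide +kernel) (by decide +kernel)
    (by decide) (by decide) (by decide) hJ hMcU hGZK hKo hrec hD36 hlev W hW hK hD3 hD4 hH hP hnt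
    hI hr hs hv

/-- **`BSD(E,3)` for `6723f1`, bucket B-add, road A** (`N = 6723`, `r = 0`, Kodaira `IV*` at `3`,
`c₃ = 3`, `D = -8`; model `[0,0,1,-189,-1006]`, `Δ = -4901067`, support `3:10;83:1`): kit
`JET.bsdp_of_jetRowCarrierAdd_three_of_frobenius` with Frobenius witnesses irr `(5, 4)`, order-3 `(7, 3)`,
mod-9 `(11, 9)` (kit table `HOME/sheets/pv2-B3-witness/witness_B_p3.tsv`, job j262920). Displayed binders: `hJ`
(READING K4), the published `hMcU` … `hlev`, the Heegner datum and the index line at the carrier `3`. CONDITIONAL;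
nothing booked. [cite: Jetchev2008, Cor. 1.5 (p. 812)] [cite: Cremona2006, Table 1 (label 6723f1)] -/
theorem bsdp_jetBadd_6723f1_3_frobenius
    (hJ : JetchevDivisibilityCarrierAdd)
    (hMcU : McCallum1991_padicValNat_card_sha_primary_add_le_of_globalDivisibility)
    (hGZK : rank_eq_analyticRank_of_analyticRank_le_one)
    (hKo : ∀ (N : ℕ) [NeZero N] (W : WeierstrassCurve ℚ) (K : Type) [Field K] [NumberField K],
      kolyvagin N W K)
    (hrec : ∀ (N : ℕ) [NeZero N] (W : WeierstrassCurve ℚ) (K : Type) [Field K] [NumberField K],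
      heegnerPointOfConductor_one_galoisConj N W K)
    (hD36 : ∀ (N : ℕ) [NeZero N] (W : WeierstrassCurve ℚ) (K : Type) [Field K] [NumberField K],
      phi_heegnerTau_mem_singularModuliField N W K)
    (hlev : ∀ {N : ℕ} [NeZero N], IsNewformOf.level_eq_conductorNorm (N := N))
    (W : WeierstrassCurve ℚ) (hW : W = ⟨0, 0, 1, (-189), (-1006)⟩)
    {N : ℕ} [NeZero N] {K : Type} [Field K] [NumberField K] (hK : IsImaginaryQuadratic K)
    (hD3 : NumberField.discr K ≠ -3) (hD4 : NumberField.discr K ≠ -4)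
    (hH : SatisfiesHeegnerHypothesis N K) {P : (W.baseChange K).toAffine.Point}
    (hP : IsHeegnerPoint N W K P) (hnt : ¬ IsOfFinAddOrder P)
    (hI : padicValNat 3 (AddSubgroup.zmultiples P).index ≤
      padicValNat 3 ((W.baseChange ℚ_[3]).localTamagawaNumber ℤ_[3]))
    (hr : W.analyticRank ≤ 1) {s : ℚ} (hs : shaAn W = (s : ℂ)) (hv : padicValRat 3 s = 0) :
    BSDp W 3 :=
  bsdp_of_jetRowCarrierAdd_three_of_frobenius 0 0 1 (-189) (-1006) (by decide +kernel)
    [(3, 4, 10), (83, 1, 1)]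
    (by intro t ht; simp only [List.mem_cons, List.not_mem_nil, or_false] at ht
        rcases ht with rfl | rfl <;> norm_num)
    (by decide +kernel) (by decide +kernel) (by decide +kernel) (by decide +kernel)
    5 7 11 (by norm_num) (by norm_num) (by norm_num) (by norm_num) (by norm_num) (by norm_num)
    (by norm_num) (by norm_num) (by decide +kernel) (by decide +kernel) (by decide +kernel)
    (n₁ := 4) (n₂ := 3) (n₃ := 9) (by decide +kernel) (by decide +kernel) (by decide +kernel)
    (by decide) (by decide) (by decide) hJ hMcU hGZK hKo hrec hD36 hlev W hW hK hD3 hD4 hH hP hnt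
    hI hr hs hv

/-- **`BSD(E,3)` for `7344y1`, bucket B-add, road A** (`N = 7344`, `r = 1`, Kodaira `IV` at `3`,
`c₃ = 3`, `D = -47`; model `[0,0,0,24,-20]`, `Δ = -1057536`, support `2:8;3:5;17:1`): kit
`JET.bsdp_of_jetRowCarrierAdd_three_of_frobenius` with Frobenius witnesses irr `(5, 8)`, order-3 `(7, 12)`,
mod-9 `(11, 9)` (kit table `HOME/sheets/pv2-B3-witness/witness_B_p3.tsv`, job j262920). Displayed binders: `hJ`
(READING K4), the published `hMcU` … `hlev`, the Heegner datum and the index line at the carrier `3`. CONDITIONAL;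
nothing booked. [cite: Jetchev2008, Cor. 1.5 (p. 812)] [cite: Cremona2006, Table 1 (label 7344y1)] -/
theorem bsdp_jetBadd_7344y1_3_frobenius
    (hJ : JetchevDivisibilityCarrierAdd)
    (hMcU : McCallum1991_padicValNat_card_sha_primary_add_le_of_globalDivisibility)
    (hGZK : rank_eq_analyticRank_of_analyticRank_le_one)
    (hKo : ∀ (N : ℕ) [NeZero N] (W : WeierstrassCurve ℚ) (K : Type) [Field K] [NumberField K],
      kolyvagin N W K)
    (hrec : ∀ (N : ℕ) [NeZero N] (W : WeierstrassCurve ℚ) (K : Type) [Field K] [NumberField K],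
      heegnerPointOfConductor_one_galoisConj N W K)
    (hD36 : ∀ (N : ℕ) [NeZero N] (W : WeierstrassCurve ℚ) (K : Type) [Field K] [NumberField K],
      phi_heegnerTau_mem_singularModuliField N W K)
    (hlev : ∀ {N : ℕ} [NeZero N], IsNewformOf.level_eq_conductorNorm (N := N))
    (W : WeierstrassCurve ℚ) (hW : W = ⟨0, 0, 0, 24, (-20)⟩)
    {N : ℕ} [NeZero N] {K : Type} [Field K] [NumberField K] (hK : IsImaginaryQuadratic K)
    (hD3 : NumberField.discr K ≠ -3) (hD4 : NumberField.discr K ≠ -4)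
    (hH : SatisfiesHeegnerHypothesis N K) {P : (W.baseChange K).toAffine.Point}
    (hP : IsHeegnerPoint N W K P) (hnt : ¬ IsOfFinAddOrder P)
    (hI : padicValNat 3 (AddSubgroup.zmultiples P).index ≤
      padicValNat 3 ((W.baseChange ℚ_[3]).localTamagawaNumber ℤ_[3]))
    (hr : W.analyticRank ≤ 1) {s : ℚ} (hs : shaAn W = (s : ℂ)) (hv : padicValRat 3 s = 0) :
    BSDp W 3 :=
  bsdp_of_jetRowCarrierAdd_three_of_frobenius 0 0 0 24 (-20) (by decide +kernel)
    [(2, 4, 8), (3, 3, 5), (17, 1, 1)]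
    (by intro t ht; simp only [List.mem_cons, List.not_mem_nil, or_false] at ht
        rcases ht with rfl | rfl | rfl <;> norm_num)
    (by decide +kernel) (by decide +kernel) (by decide +kernel) (by decide +kernel)
    5 7 11 (by norm_num) (by norm_num) (by norm_num) (by norm_num) (by norm_num) (by norm_num)
    (by norm_num) (by norm_num) (by decide +kernel) (by decide +kernel) (by decide +kernel)
    (n₁ := 8) (n₂ := 12) (n₃ := 9) (by decide +kernel) (by decide +kernel) (by decide +kernel)
    (by decide) (by decide) (by decide) hJ hMcU hGZK hKo hrec hD36 hlev W hW hK hD3 hD4 hH hP hnt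
    hI hr hs hv

/-- **`BSD(E,3)` for `8478g1`, bucket B-add, road A** (`N = 8478`, `r = 1`, Kodaira `IV*` at `3`,
`c₃ = 3`, `D = -71`; model `[1,-1,1,-272,1783]`, `Δ = 12360924`, support `2:2;3:9;157:1`): kit
`JET.bsdp_of_jetRowCarrierAdd_three_of_frobenius` with Frobenius witnesses irr `(5, 5)`, order-3 `(7, 12)`,
mod-9 `(11, 15)` (kit table `HOME/sheets/pv2-B3-witness/witness_B_p3.tsv`, job j262920). Displayed binders: `hJ`
(READING K4), the published `hMcU` … `hlev`, the Heegner datum and the index line at the carrier `3`. CONDITIONAL;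
nothing booked. [cite: Jetchev2008, Cor. 1.5 (p. 812)] [cite: Cremona2006, Table 1 (label 8478g1)] -/
theorem bsdp_jetBadd_8478g1_3_frobenius
    (hJ : JetchevDivisibilityCarrierAdd)
    (hMcU : McCallum1991_padicValNat_card_sha_primary_add_le_of_globalDivisibility)
    (hGZK : rank_eq_analyticRank_of_analyticRank_le_one)
    (hKo : ∀ (N : ℕ) [NeZero N] (W : WeierstrassCurve ℚ) (K : Type) [Field K] [NumberField K],
      kolyvagin N W K)
    (hrec : ∀ (N : ℕ) [NeZero N] (W : WeierstrassCurve ℚ) (K : Type) [Field K] [NumberField K],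
      heegnerPointOfConductor_one_galoisConj N W K)
    (hD36 : ∀ (N : ℕ) [NeZero N] (W : WeierstrassCurve ℚ) (K : Type) [Field K] [NumberField K],
      phi_heegnerTau_mem_singularModuliField N W K)
    (hlev : ∀ {N : ℕ} [NeZero N], IsNewformOf.level_eq_conductorNorm (N := N))
    (W : WeierstrassCurve ℚ) (hW : W = ⟨1, (-1), 1, (-272), 1783⟩)
    {N : ℕ} [NeZero N] {K : Type} [Field K] [NumberField K] (hK : IsImaginaryQuadratic K)
    (hD3 : NumberField.discr K ≠ -3) (hD4 : NumberField.discr K ≠ -4)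
    (hH : SatisfiesHeegnerHypothesis N K) {P : (W.baseChange K).toAffine.Point}
    (hP : IsHeegnerPoint N W K P) (hnt : ¬ IsOfFinAddOrder P)
    (hI : padicValNat 3 (AddSubgroup.zmultiples P).index ≤
      padicValNat 3 ((W.baseChange ℚ_[3]).localTamagawaNumber ℤ_[3]))
    (hr : W.analyticRank ≤ 1) {s : ℚ} (hs : shaAn W = (s : ℂ)) (hv : padicValRat 3 s = 0) :
    BSDp W 3 :=
  bsdp_of_jetRowCarrierAdd_three_of_frobenius 1 (-1) 1 (-272) 1783 (by decide +kernel)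
    [(2, 1, 2), (3, 3, 9), (157, 1, 1)]
    (by intro t ht; simp only [List.mem_cons, List.not_mem_nil, or_false] at ht
        rcases ht with rfl | rfl | rfl <;> norm_num)
    (by decide +kernel) (by decide +kernel) (by decide +kernel) (by decide +kernel)
    5 7 11 (by norm_num) (by norm_num) (by norm_num) (by norm_num) (by norm_num) (by norm_num)
    (by norm_num) (by norm_num) (by decide +kernel) (by decide +kernel) (by decide +kernel)
    (n₁ := 5) (n₂ := 12) (n₃ := 15) (by decide +kernel) (by decide +kernel) (by decide +kernel)
    (by decide) (by decide) (by decide) hJ hMcU hGZK hKo hrec hD36 hlev W hW hK hD3 hD4 hH hP hnt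
    hI hr hs hv

/-- **`BSD(E,3)` for `13554b1`, bucket B-add, road A** (`N = 13554`, `r = 1`, Kodaira `IV` at `3`,
`c₃ = 3`, `D = -47`; model `[1,-1,0,180,1872]`, `Δ = -1959583104`, support `2:7;3:5;251:2`): kit
`JET.bsdp_of_jetRowCarrierAdd_three_of_frobenius` with Frobenius witnesses irr `(5, 7)`, order-3 `(7, 3)`,
mod-9 `(11, 15)` (kit table `HOME/sheets/pv2-B3-witness/witness_B_p3.tsv`, job j262920). Displayed binders: `hJ`
(READING K4), the published `hMcU` … `hlev`, the Heegner datum and the index line at the carrier `3`. CONDITIONAL;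
nothing booked. [cite: Jetchev2008, Cor. 1.5 (p. 812)] [cite: Cremona2006, Table 1 (label 13554b1)] -/
theorem bsdp_jetBadd_13554b1_3_frobenius
    (hJ : JetchevDivisibilityCarrierAdd)
    (hMcU : McCallum1991_padicValNat_card_sha_primary_add_le_of_globalDivisibility)
    (hGZK : rank_eq_analyticRank_of_analyticRank_le_one)
    (hKo : ∀ (N : ℕ) [NeZero N] (W : WeierstrassCurve ℚ) (K : Type) [Field K] [NumberField K],
      kolyvagin N W K)
    (hrec : ∀ (N : ℕ) [NeZero N] (W : WeierstrassCurve ℚ) (K : Type) [Field K] [NumberField K],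
      heegnerPointOfConductor_one_galoisConj N W K)
    (hD36 : ∀ (N : ℕ) [NeZero N] (W : WeierstrassCurve ℚ) (K : Type) [Field K] [NumberField K],
      phi_heegnerTau_mem_singularModuliField N W K)
    (hlev : ∀ {N : ℕ} [NeZero N], IsNewformOf.level_eq_conductorNorm (N := N))
    (W : WeierstrassCurve ℚ) (hW : W = ⟨1, (-1), 0, 180, 1872⟩)
    {N : ℕ} [NeZero N] {K : Type} [Field K] [NumberField K] (hK : IsImaginaryQuadratic K)
    (hD3 : NumberField.discr K ≠ -3) (hD4 : NumberField.discr K ≠ -4)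
    (hH : SatisfiesHeegnerHypothesis N K) {P : (W.baseChange K).toAffine.Point}
    (hP : IsHeegnerPoint N W K P) (hnt : ¬ IsOfFinAddOrder P)
    (hI : padicValNat 3 (AddSubgroup.zmultiples P).index ≤
      padicValNat 3 ((W.baseChange ℚ_[3]).localTamagawaNumber ℤ_[3]))
    (hr : W.analyticRank ≤ 1) {s : ℚ} (hs : shaAn W = (s : ℂ)) (hv : padicValRat 3 s = 0) :
    BSDp W 3 :=
  bsdp_of_jetRowCarrierAdd_three_of_frobenius 1 (-1) 0 180 1872 (by decide +kernel)
    [(2, 1, 7), (3, 3, 5), (251, 1, 2)]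
    (by intro t ht; simp only [List.mem_cons, List.not_mem_nil, or_false] at ht
        rcases ht with rfl | rfl | rfl <;> norm_num)
    (by decide +kernel) (by decide +kernel) (by decide +kernel) (by decide +kernel)
    5 7 11 (by norm_num) (by norm_num) (by norm_num) (by norm_num) (by norm_num) (by norm_num)
    (by norm_num) (by norm_num) (by decide +kernel) (by decide +kernel) (by decide +kernel)
    (n₁ := 7) (n₂ := 3) (n₃ := 15) (by decide +kernel) (by decide +kernel) (by decide +kernel)
    (by decide) (by decide) (by decide) hJ hMcU hGZK hKo hrec hD36 hlev W hW hK hD3 hD4 hH hP hnt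
    hI hr hs hv

end Summit.BirchSwinnertonDyer.Rank1Residual.JET

end
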